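import Literature.Computability.Complexity.NCRealize
import HarnessLib

/-!
# Constant-size circuit gadgets for a fixed finite alphabet (trunk `CplxCore`)

The Boolean simulation of straight-line arithmetic over a FIXED finite structure `A` (a finite
field in Bürgisser 2000 TCS, §5 (B), p. 87: "As `k` is finite, `Γₙ` can be directly simulated by
Boolean circuits of size `n^{O(1)}` and depth `O(log² n)`"; "any simulation will do"): elements
of `A` are carried on `#A` wires in one-hot code (`enc`), every operation `A × A → A`, `A → A`,
constant, input literal and comparison becomes a gadget of size and depth depending only on `#A`
(`ncVec_binGadget`, `ncVec_unGadget`, `ncVec_constEnc`, `ncVec_bitEnc`, `ncVec_eqEnc`, all by the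
universal circuits of `NCRealize.lean`), and an iterated sum of `M` encoded elements of an additive
commutative monoid is a balanced tree of addition gadgets of depth `O(log M)`
(`ncVec_sumEnc`, `treeFold_addGadget`).

## References

* P. Bürgisser, *Cook's versus Valiant's hypothesis*, Theoret. Comput. Sci. 235 (2000), §5 (B),
  p. 87; R. M. Karp, V. Ramachandran, *Parallel algorithms for shared-memory machines*, Handbook
  of TCS A (1990), §4.2.2 (arithmetic by Boolean circuits).
* H. Vollmer, *Introduction to Circuit Complexity* (1999), §1.3.
-/

noncomputable section

namespace Literature.Computability.Complexity

open Finset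

/-- Bundling `M` vector-output blocks of equal depth and size bounds on the same inputs: depth
unchanged, sizes add (Vollmer 1999, §1.2). [cite: Vollmer1999, §1.2] -/
theorem NCVec.pi_finVec {ι : Type*} {M b : ℕ} {F : (ι → Bool) → Fin M → Fin b → Bool} {d s : ℕ}
    (h : ∀ j, NCVec (fun x => F x j) d s) :
    NCVec (fun x (p : Fin M × Fin b) => F x p.1 p.2) d (M * s) := by
  induction M with
  | zero =>
    exact ⟨[], fun p => p.1.elim0, GateList.WF.nil, fun g hg => by simp at hg, fun p => p.1.elim0,
      by simp, fun p => p.1.elim0, fun _ p => p.1.elim0⟩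
  | succ M ih =>
    have h1 : NCVec (fun x (p : Fin M × Fin b) => F x p.1.castSucc p.2) d (M * s) :=
      ih fun j => h j.castSucc
    have h2 := h1.pair (h (Fin.last M))
    refine ((h2.outMap fun p : Fin (M + 1) × Fin b =>
      if hj : (p.1 : ℕ) < M then Sum.inl (⟨p.1, hj⟩, p.2) else Sum.inr p.2).congr fun x p => ?_).mono
      (max_le le_rfl le_rfl) (by rw [Nat.succ_mul])
    obtain ⟨j, i⟩ := p
    by_cases hj : (j : ℕ) < M
    · simp only [hj, ↓reduceDIte, Sum.elim_inl]
      rfl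
    · simp only [hj, ↓reduceDIte, Sum.elim_inr]
      rw [(Fin.eq_last_of_not_lt hj)]

namespace FinEnc

variable {A : Type*} [Fintype A]

/-- The one-hot code of an element of the finite alphabet `A` on `#A` wires. [cite: Burgisser2000TCS, §5 (B) p. 87] -/
def enc (a : A) : Fin (Fintype.card A) → Bool := fun i => decide (Fintype.equivFin A a = i)

/-- The code is injective. [folklore] -/
theorem enc_injective : Function.Injective (enc (A := A)) := by
  intro a b h
  have := congrFun h (Fintype.equivFin A b)
  simp only [enc, decide_true] at this
  exact (Fintype.equivFin A).injective (of_decide_eq_true this)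

/-- **Constants cost `O(1)`**: the code word of `a`, from no input, at depth `1` with `#A`
gates. [cite: Burgisser2000TCS, §5 (B) p. 87] -/
theorem ncVec_constEnc {ι : Type*} (a : A) : NCVec (fun (_ : ι → Bool) => enc a) 1 (Fintype.card A) := by
  have h := (ncVec_proj (ι := ι) (Fin.elim0 : Fin 0 → ι)).comp
    (ncVec_univVec (ι' := Fin 0) fun _ => enc a)
  refine h.mono ?_ ?_ <;> simp [univBound]

/-- **Input literals cost `O(1)`**: the code word of `a₁` or `a₀` according to the input bit
`xᵢ` (the embedding `{0,1} ⊆ k` of Boolean inputs), depth `3`, size `#A · univBound 1`. [cite: Burgisser2000TCS, §5 (B) p. 87] -/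
theorem ncVec_bitEnc {ι : Type*} (i : ι) (a₀ a₁ : A) :
    NCVec (fun (x : ι → Bool) => enc (if x i then a₁ else a₀)) 3 (Fintype.card A * univBound 1) := by
  have h := (ncVec_proj (ι := ι) fun _ : Fin 1 => i).comp
    (ncVec_univVec (ι' := Fin 1) fun y => enc (if y 0 then a₁ else a₀))
  refine h.mono ?_ ?_ <;> simp

/-- **Comparison with a constant costs `O(1)`**: the bit `[u = enc a]`, depth `2 #A + 1`, size
`univBound #A`. [cite: Burgisser2000TCS, §5 (B) p. 87] -/
theorem ncVec_eqEnc (a : A) :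
    NCVec (fun (u : Fin (Fintype.card A) → Bool) (_ : Unit) => decide (u = enc a))
      (2 * Fintype.card A + 1) (univBound (Fintype.card A)) := by
  have h := ncVec_univ (ι' := Fin (Fintype.card A)) fun u _ => decide (u = enc a)
  refine h.mono ?_ ?_ <;> simp

variable [Nonempty A]

/-- Decoding (a left inverse of `enc`; arbitrary on non-code words). [folklore] -/
def dec (v : Fin (Fintype.card A) → Bool) : A := Function.invFun enc v

/-- `dec (enc a) = a`. [folklore] -/
@[simp] theorem dec_enc (a : A) : dec (enc a) = a :=
  Function.leftInverse_invFun enc_injective a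

/-! ### Gadgets -/

/-- The gadget of a binary operation: decode both halves, operate, encode. [cite: Burgisser2000TCS, §5 (B) p. 87] -/
def binGadget (f : A → A → A) (u v : Fin (Fintype.card A) → Bool) : Fin (Fintype.card A) → Bool :=
  enc (f (dec u) (dec v))

/-- On code words the gadget computes the operation. [folklore] -/
@[simp] theorem binGadget_enc (f : A → A → A) (a b : A) :
    binGadget f (enc a) (enc b) = enc (f a b) := by
  simp [binGadget]

/-- **Binary operations cost `O(1)`** (depending on `#A` only): depth `4 #A + 1`, size
`#A · univBound (2 #A)`. [cite: Burgisser2000TCS, §5 (B) p. 87] -/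
theorem ncVec_binGadget (f : A → A → A) :
    NCVec (fun (y : Fin (Fintype.card A) ⊕ Fin (Fintype.card A) → Bool) =>
      binGadget f (fun i => y (.inl i)) fun i => y (.inr i))
      (4 * Fintype.card A + 1) (Fintype.card A * univBound (2 * Fintype.card A)) := by
  have h := ncVec_univVec (ι' := Fin (Fintype.card A) ⊕ Fin (Fintype.card A))
    fun y => binGadget f (fun i => y (.inl i)) fun i => y (.inr i)
  refine h.mono ?_ ?_
  · simp; omega
  · simp [two_mul]

/-- The gadget of a unary operation. [cite: Burgisser2000TCS, §5 (B) p. 87] -/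
def unGadget (f : A → A) (u : Fin (Fintype.card A) → Bool) : Fin (Fintype.card A) → Bool :=
  enc (f (dec u))

/-- On code words the gadget computes the operation. [folklore] -/
@[simp] theorem unGadget_enc (f : A → A) (a : A) : unGadget f (enc a) = enc (f a) := by
  simp [unGadget]

/-- **Unary operations cost `O(1)`**: depth `2 #A + 1`, size `#A · univBound #A`. [cite: Burgisser2000TCS, §5 (B) p. 87] -/
theorem ncVec_unGadget (f : A → A) :
    NCVec (fun (u : Fin (Fintype.card A) → Bool) => unGadget f u)
      (2 * Fintype.card A + 1) (Fintype.card A * univBound (Fintype.card A)) := by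
  have h := ncVec_univVec (ι' := Fin (Fintype.card A)) fun u => unGadget f u
  refine h.mono ?_ ?_ <;> simp

/-- The gadget of a ternary operation (the triple products `[ν : w] · [w₁] · [w₂]` of the
Valiant–Skyum–Berkowitz–Rackoff stages). [cite: Burgisser2000TCS, §5 (B) p. 87] -/
def terGadget (f : A → A → A → A) (u v w : Fin (Fintype.card A) → Bool) : Fin (Fintype.card A) → Bool :=
  enc (f (dec u) (dec v) (dec w))

/-- On code words the gadget computes the operation. [folklore] -/
@[simp] theorem terGadget_enc (f : A → A → A → A) (a b c : A) :
    terGadget f (enc a) (enc b) (enc c) = enc (f a b c) := by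
  simp [terGadget]

/-- **Ternary operations cost `O(1)`**: depth `6 #A + 1`, size `#A · univBound (3 #A)`. [cite: Burgisser2000TCS, §5 (B) p. 87] -/
theorem ncVec_terGadget (f : A → A → A → A) :
    NCVec (fun (y : Fin (Fintype.card A) ⊕ (Fin (Fintype.card A) ⊕ Fin (Fintype.card A)) → Bool) =>
      terGadget f (fun i => y (.inl i)) (fun i => y (.inr (.inl i))) fun i => y (.inr (.inr i)))
      (6 * Fintype.card A + 1) (Fintype.card A * univBound (3 * Fintype.card A)) := by
  have h := ncVec_univVec
    (ι' := Fin (Fintype.card A) ⊕ (Fin (Fintype.card A) ⊕ Fin (Fintype.card A)))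
    fun y => terGadget f (fun i => y (.inl i)) (fun i => y (.inr (.inl i))) fun i => y (.inr (.inr i))
  refine h.mono ?_ ?_
  · simp; omega
  · simp only [Fintype.card_sum, Fintype.card_fin]
    ring_nf
    exact le_rfl

/-! ### Iterated sums -/

variable [AddCommMonoid A]

/-- **A balanced tree of addition gadgets sums**: on code words of `a₀, …, a_{M-1}` the tree of
`binGadget (· + ·)` outputs the code word of `∑ⱼ aⱼ` (`treeFold_map` with the homomorphism `enc`,
and `treeFold_add`). [folklore] -/
theorem treeFold_addGadget (M : ℕ) (a : Fin M → A) :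
    treeFold (binGadget (A := A) (· + ·)) (enc 0) M (fun j => enc (a j)) = enc (∑ j, a j) := by
  rw [← treeFold_add M a]
  exact (treeFold_map (· + ·) (0 : A) (binGadget (A := A) (· + ·)) (enc 0) enc
    (fun x y => (binGadget_enc _ x y).symm) rfl M a).symm

/-- **Iterated sums of `M ≥ 1` encoded elements**: if a block outputs the code words of
`a_j(x)`, `j < M`, at depth `d` with `s` gates, then the code word of `∑ⱼ a_j(x)` is realized at
depth `d + ⌈log₂ M⌉ (4 #A + 1)` with `s + (M − 1) #A · univBound (2 #A)` gates
(Bürgisser 2000 TCS §5 (B); Vollmer 1999, §1.3). [cite: Burgisser2000TCS, §5 (B) p. 87] [cite: Vollmer1999, §1.3] -/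
theorem ncVec_sumEnc {ι : Type*} {M : ℕ} (hM : 1 ≤ M) {a : (ι → Bool) → Fin M → A} {d s : ℕ}
    (h : NCVec (fun (x : ι → Bool) (p : Fin M × Fin (Fintype.card A)) => enc (a x p.1) p.2) d s) :
    NCVec (fun (x : ι → Bool) => enc (∑ j, a x j)) (d + Nat.clog 2 M * (4 * Fintype.card A + 1))
      (s + (M - 1) * (Fintype.card A * univBound (2 * Fintype.card A))) := by
  have ht := NCVec.tree (ncVec_binGadget (A := A) (· + ·)) (enc 0) hM h
  refine ht.congr fun x i => ?_
  have := congrFun (treeFold_addGadget M (a x)) i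
  exact this

end FinEnc

end Literature.Computability.Complexity
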